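import Literature.NumberTheory.LFunctions.KeiperLiZeroSum
import Summits.RiemannHypothesis.RiemannHypothesis.Theorems.Splittings.LiCriterionProgressions
import HarnessLib

/-!
# Splittings — Li index sets, part 1/3: definition-free estimates (simultaneous recurrence along block sums,
# the `q`-Beurling points, and the elementary inequalities of Bombieri–Lagarias' proof)

Cell rh-split, seat rh-split-li-neg g2 (brief sha16 f79c5f09d8bcb036), card `run/shared/lean/pub/rh-split/cards/SPLIT-li-neg.md`
gen-2 addendum (census V10/V12 «sparse / lacunary / syndetic index sets» settled structurally; BY-PRODUCT BP-6).
This part carries the definition-free lemmas used by parts 2/3 (`LiIndexSetsRecurrence.lean`) and 3/3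
(`LiIndexSets.lean`):

* `exists_blockSum_forall_half_le_re_pow` — **simultaneous recurrence along block sums** (the Dirichlet/Kronecker
  step of Bombieri–Lagarias' proof run inside an IP-type set): for finitely many unit complex numbers, a sequence of
  positive integers `x` and any `N`, some block sum `n = x_m + … + x_{m'−1} ≥ N` has `Re(z_iⁿ) ≥ 1/2` for every `i`
  (Bolzano–Weierstrass in `ℂ^B`);
* `re_inv_one_sub_lt_half`, `norm_beurling_w`, `beurling_sum_eq` — the points `(1 − r ζ_q^j)⁻¹` lie strictly LEFT of
  the critical line for `r > 1`, and their Li sums are `Σ_{j<q} Re[1 − (r ζ_q^j)ⁿ] = q` if `q ∤ n`, `= q(1 − rⁿ)` if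
  `q ∣ n` (root-of-unity filter, tree `LiProgression.sum_rootOfUnity_pow_mul`);
* the elementary inequalities of [BombieriLagarias1999, Thm 1, proof] for one point `ρ`: the modulus test
  `1 < ‖(1 − 1/ρ)⁻¹‖ ↔ 1/2 < Re ρ`, `norm_sub_one_le_of_le_norm`, the tail estimate `abs_re_term_le`
  (`|Re[1 − (1 − 1/ρ)⁻ⁿ]| ≤ 18 n² · weight` for `n ≤ ‖ρ − 1‖`), and `finite_norm_le` (finitely many family members
  in any disc, from summability of the weight `BombieriLagarias.weight`).

References: E. Bombieri, J. C. Lagarias, J. Number Theory 77 (1999) 274–287, Thm. 1 [BombieriLagarias1999].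

Provenance: cell rh-split, seat rh-split-li-neg g2, scratch `HOME/rh-split-li-neg/LiIndexSets.lean` (sha16
a6d03a2d9de497a7, 964 lines, namespace `…Scratch.LiIndexSets`; proofs verbatim), re-homed under
`Theorems/Splittings/` in three files (`LiIndexSetsPrelims` — definition-free estimates; `LiIndexSetsRecurrence` —
the notions `IsLiRecurrent` / `LiPosOn` / `IsThick` / `beurlingFamily` / `MultisetLiCriterionOn` and their API;
`LiIndexSets` — Bombieri–Lagarias along a recurrent index set and the zeta-level dichotomy) by rh-split-typer-1 g2
on the lead's ruling 2026-08-26T20:32Z (BY-PRODUCT BP-6; optional filing after referee replay + label).  Referee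
(rh-split-ref g0) addendum 20:37Z on cards/SPLIT-li-neg.md: replay rc 0, std on `riemannHypothesis_iff_liPosOn`;
«dichotomy (RH ↔ LiPosOn S) ∨ (RH ↔ LiPosOn Sᶜ) for EVERY S — partition-regularity step and q-Beurling
non-recurrent witness re-checked by hand; LABEL: Li index axis = NO SLACK BY THEOREM (recurrent parts RH-equivalent
alone, F1-free; non-recurrent parts RH-implied, ζ-level converse undecided, multiset-level refuted in kernel)».
Typer-1 g2 replay of the 964-line scratch: farm rc 0, 0 warnings, 0 sorry, `#print axioms li_index_dichotomy_raw` =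
[propext, Classical.choice, Quot.sound].

HONEST LABEL: «SPLITTING SEARCH over kernel-typed RH-EQUIVALENCES; a splitting A ∧ B ⟹ RH is CONDITIONAL
bookkeeping unless A and B are both proved; nothing here bears on the truth of RH.»
-/

set_option linter.dupNamespace false

noncomputable section

open Complex Filter Topology Set
open scoped ComplexConjugate Real

namespace Summit.RiemannHypothesis.RiemannHypothesis.Theorems.Splittings.LiIndexSets

open Literature.NumberTheory.LFunctions
open Literature.NumberTheory.LFunctions.BombieriLagarias
open Summit.RiemannHypothesis.RiemannHypothesis.Theorems.Splittings

/-! ## §1 Simultaneous recurrence along block sums (Bolzano–Weierstrass) -/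

/-- A strictly monotone `φ : ℕ → ℕ` gains at least `d` over `d` steps: `φ K + d ≤ φ (K + d)`. [folklore] -/
theorem strictMono_add_le {φ : ℕ → ℕ} (hφ : StrictMono φ) (K d : ℕ) : φ K + d ≤ φ (K + d) := by
  induction d with
  | zero => simp
  | succ d ih =>
    have := hφ (show K + d < K + (d + 1) by omega)
    omega

/-- **Simultaneous recurrence along block sums** (the Dirichlet/Kronecker step of Bombieri–Lagarias'
proof, run inside an IP-type set): for finitely many unit complex numbers, a sequence of positive
integers `x` and any `N`, some block sum `n = x_m + … + x_{m'−1} ≥ N` has `Re(z_iⁿ) ≥ 1/2` for every `i`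
— Bolzano–Weierstrass for `k ↦ (z_i^{x_0+…+x_{k−1}})_i` in `ℂ^B`.  (The tree's private
`BombieriLagarias.exists_forall_half_le_re_pow` is the case `x ≡ N+1`.) -/
theorem exists_blockSum_forall_half_le_re_pow {ι : Type*} (B : Finset ι) (z : ι → ℂ)
    (hz : ∀ i ∈ B, ‖z i‖ = 1) (x : ℕ → ℕ) (hx : ∀ j, 1 ≤ x j) (N : ℕ) :
    ∃ m m' : ℕ, m < m' ∧ N ≤ ∑ j ∈ Finset.Ico m m', x j ∧
      ∀ i ∈ B, 1 / 2 ≤ (z i ^ ∑ j ∈ Finset.Ico m m', x j).re := by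
  classical
  set P : ℕ → ℕ := fun k ↦ ∑ j ∈ Finset.range k, x j with hP
  set xs : ℕ → (B → ℂ) := fun k i ↦ z i ^ P k with hxs
  have hxmem : ∀ k, xs k ∈ Metric.closedBall (0 : B → ℂ) 1 := by
    intro k
    rw [Metric.mem_closedBall, dist_zero_right, pi_norm_le_iff_of_nonneg zero_le_one]
    intro i
    simp only [hxs, norm_pow, hz i i.2, one_pow, le_refl]
  obtain ⟨a, -, φ, hφ, hlim⟩ := tendsto_subseq_of_bounded Metric.isBounded_closedBall hxmem
  obtain ⟨K, hK⟩ := Metric.tendsto_atTop.1 hlim (1 / 4) (by norm_num)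
  have hd : dist (xs (φ (K + (N + 1)))) (xs (φ K)) < 1 / 2 := by
    calc dist (xs (φ (K + (N + 1)))) (xs (φ K))
        ≤ dist (xs (φ (K + (N + 1)))) a + dist (xs (φ K)) a := dist_triangle_right _ _ _
      _ < 1 / 4 + 1 / 4 := add_lt_add (hK _ (by omega)) (hK _ le_rfl)
      _ = 1 / 2 := by norm_num
  have hmm' : φ K + (N + 1) ≤ φ (K + (N + 1)) := strictMono_add_le hφ K (N + 1)
  refine ⟨φ K, φ (K + (N + 1)), by omega, ?_, fun i hi ↦ ?_⟩
  · calc N ≤ (φ (K + (N + 1)) - φ K) * 1 := by omega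
      _ = ∑ j ∈ Finset.Ico (φ K) (φ (K + (N + 1))), 1 := by simp
      _ ≤ ∑ j ∈ Finset.Ico (φ K) (φ (K + (N + 1))), x j := Finset.sum_le_sum fun j _ ↦ hx j
  · have hi' := (dist_pi_lt_iff (by norm_num : (0 : ℝ) < 1 / 2)).1 hd ⟨i, hi⟩
    rw [dist_eq_norm] at hi'
    simp only [hxs] at hi'
    set n : ℕ := ∑ j ∈ Finset.Ico (φ K) (φ (K + (N + 1))), x j with hn
    have hPP : P (φ (K + (N + 1))) = P (φ K) + n := by
      simp only [hP, hn]
      exact (Finset.sum_range_add_sum_Ico x (by omega)).symm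
    have hfac : z i ^ P (φ (K + (N + 1))) - z i ^ P (φ K) = z i ^ P (φ K) * (z i ^ n - 1) := by
      rw [hPP, pow_add]; ring
    rw [hfac, norm_mul, norm_pow, hz i hi, one_pow, one_mul] at hi'
    have hre : -(z i ^ n - 1).re ≤ ‖z i ^ n - 1‖ := by
      have := Complex.re_le_norm (-(z i ^ n - 1))
      rwa [neg_re, norm_neg] at this
    have e : (z i ^ n).re = 1 + (z i ^ n - 1).re := by
      simp only [sub_re, one_re]; ring
    rw [e]
    linarith

/-! ## §2 The `q`-Beurling points `(1 − r ζ_q^j)⁻¹` -/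

/-- `1 - w ≠ 0` whenever `‖w‖ > 1`. [folklore] -/
theorem one_sub_ne_zero_of_one_lt_norm {w : ℂ} (hw : 1 < ‖w‖) : 1 - w ≠ 0 := by
  intro h
  have : w = 1 := by linear_combination -h
  rw [this, norm_one] at hw
  exact lt_irrefl _ hw

/-- `Re (1 − w)⁻¹ < 1/2` whenever `|w| > 1`. -/
theorem re_inv_one_sub_lt_half {w : ℂ} (hw : 1 < ‖w‖) : ((1 - w)⁻¹).re < 1 / 2 := by
  have hne : 1 - w ≠ 0 := one_sub_ne_zero_of_one_lt_norm hw
  have hpos : 0 < Complex.normSq (1 - w) := Complex.normSq_pos.2 hne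
  rw [Complex.inv_re, div_lt_iff₀ hpos]
  have h1 : Complex.normSq (1 - w) = (1 - w.re) ^ 2 + w.im ^ 2 := by
    rw [Complex.normSq_apply]; simp only [sub_re, one_re, sub_im, one_im, zero_sub]; ring
  have h2 : ‖w‖ ^ 2 = w.re ^ 2 + w.im ^ 2 := by rw [Complex.sq_norm, Complex.normSq_apply]; ring
  have h3 : 1 < ‖w‖ ^ 2 := by nlinarith [norm_nonneg w]
  simp only [sub_re, one_re]
  nlinarith

/-- `‖r ζ_q^j‖ = r` for `r ≥ 0` (`ζ_q = e^{2πi/q}`). [folklore] -/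
theorem norm_beurling_w {q : ℕ} (hq : q ≠ 0) {r : ℝ} (hr : 0 ≤ r) (j : ℕ) :
    ‖(r : ℂ) * exp (2 * π * I / q) ^ j‖ = r := by
  rw [norm_mul, LiProgression.norm_rootOfUnity_pow hq, mul_one, Complex.norm_real, Real.norm_of_nonneg hr]

/-- The Li sums of the points `(1 − r ζ_q^j)⁻¹`, `j < q`: `Σ_{j<q} Re[1 − (r ζ_q^j)ⁿ] = q` if `q ∤ n`
and `= q (1 − rⁿ)` if `q ∣ n` (root-of-unity filter). -/
theorem beurling_sum_eq {q : ℕ} (hq : q ≠ 0) (r : ℝ) (n : ℕ) :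
    ∑ j ∈ Finset.range q, (1 - ((r : ℂ) * exp (2 * π * I / q) ^ j) ^ n).re
      = if q ∣ n then (q : ℝ) * (1 - r ^ n) else (q : ℝ) := by
  have hsum := LiProgression.sum_rootOfUnity_pow_mul hq n
  have e : ∀ j ∈ Finset.range q, (1 - ((r : ℂ) * exp (2 * π * I / q) ^ j) ^ n).re
      = 1 - r ^ n * ((exp (2 * π * I / q) ^ j) ^ n).re := by
    intro j _
    rw [mul_pow, sub_re, one_re, ← Complex.ofReal_pow, Complex.re_ofReal_mul]
  rw [Finset.sum_congr rfl e, Finset.sum_sub_distrib, ← Finset.mul_sum, ← Complex.re_sum, hsum]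
  split_ifs with h
  · simp only [Finset.sum_const, Finset.card_range, nsmul_eq_mul, mul_one, Complex.natCast_re]; ring
  · simp only [Finset.sum_const, Finset.card_range, nsmul_eq_mul, mul_one, Complex.zero_re, mul_zero,
      sub_zero]

/-! ## §3 The elementary inequalities of Bombieri–Lagarias' proof -/

section BL

variable {ι : Type*} {ρ : ι → ℂ} {m : ι → ℕ}

/-- `(1 - 1/ρ)⁻¹ = ρ/(ρ-1)` (`ρ ≠ 0`). [folklore] -/
theorem inv_one_sub_inv_eq {ρ : ℂ} (h0 : ρ ≠ 0) : (1 - 1 / ρ)⁻¹ = ρ / (ρ - 1) := by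
  rw [one_sub_div h0, inv_div]

/-- `(1 - 1/ρ)⁻¹ = 1 + (ρ-1)⁻¹` (`ρ ≠ 0, 1`). [folklore] -/
theorem inv_one_sub_inv_eq_one_add {ρ : ℂ} (h0 : ρ ≠ 0) (h1 : ρ ≠ 1) :
    (1 - 1 / ρ)⁻¹ = 1 + (ρ - 1)⁻¹ := by
  have h1' : ρ - 1 ≠ 0 := sub_ne_zero.2 h1
  rw [inv_one_sub_inv_eq h0]
  field_simp
  ring

/-- `‖ρ‖² = ‖ρ-1‖² + (2 Re ρ - 1)`. [folklore] -/
theorem norm_sq_eq_norm_sub_one_sq_add (ρ : ℂ) : ‖ρ‖ ^ 2 = ‖ρ - 1‖ ^ 2 + (2 * ρ.re - 1) := by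
  rw [Complex.sq_norm, Complex.sq_norm, Complex.normSq_apply, Complex.normSq_apply]
  simp only [sub_re, one_re, sub_im, one_im, sub_zero]
  ring

/-- `1 < ‖(1 - 1/ρ)⁻¹‖ ↔ 1/2 < Re ρ` (`ρ ≠ 1`): the modulus test for the half-plane. [cite: BombieriLagarias1999, Theorem 1, proof] -/
theorem one_lt_norm_inv_one_sub_inv_iff {ρ : ℂ} (h1 : ρ ≠ 1) :
    1 < ‖(1 - 1 / ρ)⁻¹‖ ↔ 1 / 2 < ρ.re := by
  rw [← not_le, norm_inv_one_sub_inv_le_one_iff h1, not_le]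

/-- `‖(1 - 1/ρ)⁻¹‖² = 1 + (2 Re ρ - 1)/‖ρ-1‖²` (`ρ ≠ 0, 1`). [folklore] -/
theorem norm_inv_one_sub_inv_sq {ρ : ℂ} (h0 : ρ ≠ 0) (h1 : ρ ≠ 1) :
    ‖(1 - 1 / ρ)⁻¹‖ ^ 2 = 1 + (2 * ρ.re - 1) / ‖ρ - 1‖ ^ 2 := by
  have h1' : ρ - 1 ≠ 0 := sub_ne_zero.2 h1
  have hpos : 0 < ‖ρ - 1‖ := norm_pos_iff.2 h1'
  rw [inv_one_sub_inv_eq h0, norm_div, div_pow, norm_sq_eq_norm_sub_one_sq_add]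
  field_simp

/-- If `‖(1 - 1/ρ)⁻¹‖ ≥ μ > 1` then `‖ρ - 1‖ ≤ max 1 (3/(μ²-1))`: large modulus forces `ρ` near `1`. [cite: BombieriLagarias1999, Theorem 1, proof] -/
theorem norm_sub_one_le_of_le_norm {ρ : ℂ} {μ : ℝ} (hμ : 1 < μ) (h1 : ρ ≠ 1)
    (h : μ ≤ ‖(1 - 1 / ρ)⁻¹‖) : ‖ρ - 1‖ ≤ max 1 (3 / (μ ^ 2 - 1)) := by
  have h0 : ρ ≠ 0 := by
    rintro rfl
    norm_num at h
    linarith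
  have h1' : ρ - 1 ≠ 0 := sub_ne_zero.2 h1
  have hpos : 0 < ‖ρ - 1‖ := norm_pos_iff.2 h1'
  have hμ2 : 0 < μ ^ 2 - 1 := by nlinarith
  have hsq : μ ^ 2 ≤ ‖(1 - 1 / ρ)⁻¹‖ ^ 2 := pow_le_pow_left₀ (by linarith) h 2
  rw [norm_inv_one_sub_inv_sq h0 h1] at hsq
  have hre : ρ.re ≤ ‖ρ‖ := Complex.re_le_norm ρ
  have hρ : ‖ρ‖ ≤ ‖ρ - 1‖ + 1 := by
    calc ‖ρ‖ = ‖(ρ - 1) + 1‖ := by ring_nf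
      _ ≤ ‖ρ - 1‖ + ‖(1 : ℂ)‖ := norm_add_le _ _
      _ = ‖ρ - 1‖ + 1 := by rw [norm_one]
  have key : (μ ^ 2 - 1) * ‖ρ - 1‖ ^ 2 ≤ 2 * ‖ρ - 1‖ + 1 := by
    have : (μ ^ 2 - 1) ≤ (2 * ρ.re - 1) / ‖ρ - 1‖ ^ 2 := by linarith
    rw [le_div_iff₀ (by positivity)] at this
    linarith
  rcases le_or_gt ‖ρ - 1‖ 1 with hle | hgt
  · exact hle.trans (le_max_left _ _)
  · refine le_trans ?_ (le_max_right _ _)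
    rw [le_div_iff₀ hμ2]
    nlinarith

/-- `Re (1 - wⁿ) ≤ 1 + ‖w‖ⁿ`. [folklore] -/
theorem re_one_sub_pow_le (w : ℂ) (n : ℕ) : (1 - w ^ n).re ≤ 1 + ‖w‖ ^ n := by
  have h1 : -(w ^ n).re ≤ ‖w ^ n‖ := by
    have := Complex.re_le_norm (-(w ^ n))
    rwa [neg_re, norm_neg] at this
  simp only [sub_re, one_re]
  rw [norm_pow] at h1
  linarith

/-- Binomial remainder: `‖(1+u)ⁿ - 1 - n u‖ ≤ (1+‖u‖)ⁿ - 1 - n‖u‖`. [folklore] -/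
theorem norm_one_add_pow_sub_le (u : ℂ) (n : ℕ) :
    ‖(1 + u) ^ n - 1 - n * u‖ ≤ (1 + ‖u‖) ^ n - 1 - n * ‖u‖ := by
  induction n with
  | zero => simp
  | succ n ih =>
    have e : (1 + u) ^ (n + 1) - 1 - (↑(n + 1) : ℂ) * u
        = (1 + u) * ((1 + u) ^ n - 1 - n * u) + n * u ^ 2 := by
      push_cast; ring
    rw [e]
    have hu : ‖1 + u‖ ≤ 1 + ‖u‖ := by
      calc ‖1 + u‖ ≤ ‖(1 : ℂ)‖ + ‖u‖ := norm_add_le _ _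
        _ = 1 + ‖u‖ := by rw [norm_one]
    calc ‖(1 + u) * ((1 + u) ^ n - 1 - n * u) + n * u ^ 2‖
        ≤ ‖(1 + u) * ((1 + u) ^ n - 1 - n * u)‖ + ‖(n : ℂ) * u ^ 2‖ := norm_add_le _ _
      _ = ‖1 + u‖ * ‖(1 + u) ^ n - 1 - n * u‖ + n * ‖u‖ ^ 2 := by
          rw [norm_mul, norm_mul, norm_pow, Complex.norm_natCast]
      _ ≤ (1 + ‖u‖) * ((1 + ‖u‖) ^ n - 1 - n * ‖u‖) + n * ‖u‖ ^ 2 := by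
          gcongr
      _ = (1 + ‖u‖) ^ (n + 1) - 1 - (↑(n + 1) : ℝ) * ‖u‖ := by push_cast; ring

/-- `(1+a)ⁿ - 1 - n a ≤ (n a)²` for `0 ≤ a`, `n a ≤ 1` (via `(1+a)ⁿ ≤ e^{na}` and `|eˣ - 1 - x| ≤ x²` on `|x| ≤ 1`). [folklore] -/
theorem one_add_pow_sub_le_sq {a : ℝ} (ha : 0 ≤ a) {n : ℕ} (hna : n * a ≤ 1) :
    (1 + a) ^ n - 1 - n * a ≤ (n * a) ^ 2 := by
  have h1 : (1 + a) ^ n ≤ Real.exp (n * a) := by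
    calc (1 + a) ^ n ≤ (Real.exp a) ^ n := by
          refine pow_le_pow_left₀ (by linarith) ?_ n
          have := Real.add_one_le_exp a
          linarith
      _ = Real.exp (n * a) := by rw [← Real.exp_nat_mul]
  have h2 : |Real.exp (n * a) - 1 - n * a| ≤ (n * a) ^ 2 :=
    Real.abs_exp_sub_one_sub_id_le (by rw [abs_of_nonneg (by positivity)]; exact hna)
  have h3 := (abs_le.1 h2).2
  linarith

/-- The tail estimate of Bombieri–Lagarias' proof: for `n ≤ ‖ρ - 1‖`, `|Re[1 - (1 - 1/ρ)⁻ⁿ]| ≤ 18 n² (1+|Re ρ|)/(1+‖ρ‖)²` — the Li term is dominated by the convergence weight. [cite: BombieriLagarias1999, Theorem 1, proof] -/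
theorem abs_re_term_le {ρ : ℂ} {n : ℕ} (hn : 1 ≤ n) (hρ : (n : ℝ) ≤ ‖ρ - 1‖) :
    |(1 - (1 - 1 / ρ)⁻¹ ^ n).re| ≤ 18 * (n : ℝ) ^ 2 * ((1 + |ρ.re|) / (1 + ‖ρ‖) ^ 2) := by
  have hn1 : (1 : ℝ) ≤ n := by exact_mod_cast hn
  have hρ1 : 1 ≤ ‖ρ - 1‖ := hn1.trans hρ
  have hpos : 0 < ‖ρ - 1‖ := by linarith
  have h1 : ρ ≠ 1 := by
    rintro rfl; simp at hpos
  have hRHS : 0 ≤ 18 * (n : ℝ) ^ 2 * ((1 + |ρ.re|) / (1 + ‖ρ‖) ^ 2) := by positivity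
  by_cases h0 : ρ = 0
  · subst h0
    simp
  have h1' : ρ - 1 ≠ 0 := sub_ne_zero.2 h1
  set u : ℂ := (ρ - 1)⁻¹ with hu
  have hw : (1 - 1 / ρ)⁻¹ = 1 + u := inv_one_sub_inv_eq_one_add h0 h1
  have hnu : ‖u‖ = ‖ρ - 1‖⁻¹ := by rw [hu, norm_inv]
  have hua : (n : ℝ) * ‖u‖ ≤ 1 := by
    rw [hnu, ← div_eq_mul_inv, div_le_one hpos]; exact hρ
  set E : ℂ := (1 + u) ^ n - 1 - n * u with hE
  have hdec : 1 - (1 - 1 / ρ)⁻¹ ^ n = -(n * u) - E := by rw [hw, hE]; ring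
  have hEn : ‖E‖ ≤ ((n : ℝ) * ‖u‖) ^ 2 :=
    (norm_one_add_pow_sub_le u n).trans (one_add_pow_sub_le_sq (norm_nonneg _) hua)
  have hure : u.re = (ρ.re - 1) / ‖ρ - 1‖ ^ 2 := by
    rw [hu, Complex.inv_re, Complex.normSq_eq_norm_sq]
    simp
  have hre_abs : |(n : ℝ) * u.re| ≤ n * ((1 + |ρ.re|) / ‖ρ - 1‖ ^ 2) := by
    rw [abs_mul, abs_of_nonneg (by positivity : (0 : ℝ) ≤ n), hure, abs_div,
      abs_of_pos (by positivity : (0 : ℝ) < ‖ρ - 1‖ ^ 2)]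
    gcongr
    calc |ρ.re - 1| ≤ |ρ.re| + |(1 : ℝ)| := abs_sub _ _
      _ = 1 + |ρ.re| := by rw [abs_one]; ring
  have hEre : |E.re| ≤ (n : ℝ) ^ 2 / ‖ρ - 1‖ ^ 2 := by
    calc |E.re| ≤ ‖E‖ := Complex.abs_re_le_norm E
      _ ≤ ((n : ℝ) * ‖u‖) ^ 2 := hEn
      _ = (n : ℝ) ^ 2 / ‖ρ - 1‖ ^ 2 := by rw [hnu, mul_pow, inv_pow, div_eq_mul_inv]
  have hcomb : |(1 - (1 - 1 / ρ)⁻¹ ^ n).re| ≤ 2 * (n : ℝ) ^ 2 * ((1 + |ρ.re|) / ‖ρ - 1‖ ^ 2) := by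
    rw [hdec]
    simp only [sub_re, neg_re, mul_re, natCast_re, natCast_im, zero_mul, sub_zero]
    calc |-(↑n * u.re) - E.re| ≤ |-(↑n * u.re)| + |E.re| := abs_sub _ _
      _ = |↑n * u.re| + |E.re| := by rw [abs_neg]
      _ ≤ n * ((1 + |ρ.re|) / ‖ρ - 1‖ ^ 2) + (n : ℝ) ^ 2 / ‖ρ - 1‖ ^ 2 := add_le_add hre_abs hEre
      _ ≤ (n : ℝ) ^ 2 * ((1 + |ρ.re|) / ‖ρ - 1‖ ^ 2) + (n : ℝ) ^ 2 * ((1 + |ρ.re|) / ‖ρ - 1‖ ^ 2) := by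
          gcongr
          · calc (n : ℝ) = n * 1 := (mul_one _).symm
              _ ≤ n * n := by gcongr
              _ = (n : ℝ) ^ 2 := (sq _).symm
          · rw [← mul_div_assoc]
            exact div_le_div_of_nonneg_right
              (le_mul_of_one_le_right (by positivity) (by linarith [abs_nonneg ρ.re])) (by positivity)
      _ = 2 * (n : ℝ) ^ 2 * ((1 + |ρ.re|) / ‖ρ - 1‖ ^ 2) := by ring
  have hρ' : ‖ρ‖ ≤ ‖ρ - 1‖ + 1 := by
    calc ‖ρ‖ = ‖(ρ - 1) + 1‖ := by ring_nf
      _ ≤ ‖ρ - 1‖ + ‖(1 : ℂ)‖ := norm_add_le _ _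
      _ = ‖ρ - 1‖ + 1 := by rw [norm_one]
  have h9 : (1 + ‖ρ‖) ^ 2 ≤ 9 * ‖ρ - 1‖ ^ 2 := by nlinarith [norm_nonneg ρ]
  calc |(1 - (1 - 1 / ρ)⁻¹ ^ n).re| ≤ 2 * (n : ℝ) ^ 2 * ((1 + |ρ.re|) / ‖ρ - 1‖ ^ 2) := hcomb
    _ ≤ 2 * (n : ℝ) ^ 2 * (9 * ((1 + |ρ.re|) / (1 + ‖ρ‖) ^ 2)) := by
        gcongr 2 * (n : ℝ) ^ 2 * ?_
        rw [mul_div_assoc', div_le_div_iff₀ (by positivity) (by positivity)]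
        calc (1 + |ρ.re|) * (1 + ‖ρ‖) ^ 2 ≤ (1 + |ρ.re|) * (9 * ‖ρ - 1‖ ^ 2) := by gcongr
          _ = 9 * (1 + |ρ.re|) * ‖ρ - 1‖ ^ 2 := by ring
    _ = 18 * (n : ℝ) ^ 2 * ((1 + |ρ.re|) / (1 + ‖ρ‖) ^ 2) := by ring

/-- For a Bombieri–Lagarias family (multiplicities `≥ 1`, summable weight) the zeros in any disc `‖ρ_i‖ ≤ r` are finite in number. [cite: BombieriLagarias1999, Theorem 1, proof] -/
theorem finite_norm_le (hm : ∀ i, 0 < m i) (hR : Summable (weight ρ m)) (r : ℝ) :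
    {i | ‖ρ i‖ ≤ r}.Finite := by
  set R : ℝ := max r 0 with hRdef
  have hR0 : 0 ≤ R := le_max_right _ _
  have hε : (0 : ℝ) < 1 / (1 + R) ^ 2 := by positivity
  have hev := hR.tendsto_cofinite_zero.eventually (gt_mem_nhds hε)
  refine (Filter.eventually_cofinite.1 hev).subset fun i (hi : ‖ρ i‖ ≤ r) ↦ ?_
  simp only [Set.mem_setOf_eq, not_lt]
  have hir : ‖ρ i‖ ≤ R := hi.trans (le_max_left _ _)
  have hm1 : (1 : ℝ) ≤ m i := by exact_mod_cast hm i
  unfold weight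
  calc 1 / (1 + R) ^ 2 ≤ 1 * ((1 + 0) / (1 + ‖ρ i‖) ^ 2) := by
        rw [one_mul, add_zero]
        gcongr
    _ ≤ (m i : ℝ) * ((1 + |(ρ i).re|) / (1 + ‖ρ i‖) ^ 2) := by
        gcongr
        exact abs_nonneg _

end BL

end Summit.RiemannHypothesis.RiemannHypothesis.Theorems.Splittings.LiIndexSets

end
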